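import Literature.NumberTheory.Automorphic.UnitaryGroupBorelRefinedClassMap
import HarnessLib

/-!
# The Borel side of the fine `𝔬`-expansion of `U(J₃)`, split by type: central × unipotent ∕ singular ∕ regular hyperbolic
(Rogawski, *Automorphic Representations of Unitary Groups in Three Variables* (1990), §7.6 (7.6.1): the fine
`𝔬`-expansion of `T_G(f)` is the sum over the stable elliptic classes plus the sum over the regular classes meeting `M`,
the singular classes of `M` — central `z` and `d(α, β, α)` — being treated separately in Props. 7.2.2, 7.3.1–7.3.2;
Arthur, *A trace formula for reductive groups I*, Duke Math. J. 45 (1978), §8.)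

Topic `NumberTheory/Automorphic`; namespace `Literature.NumberTheory.Automorphic.UnitaryGroup`. THEOREMS ONLY over
accepted tree modules: no definition, no named fact, no instance, no notation, no `sorry`. Item (L5-0c) of the T1-qs
road of `Cruxes/H413/Lines/F0_T1InnerFormTraceIdentity.lean` (cell `pub/hodgecm-mathlib`, crux H413). The LAW 5 socket
★ `arthurTrace_eq_sum_orbital_add_sum_borelRefined_cm` (★ `UnitaryGroupArthurTraceBorelRefined`) writes the Borel side
of `J(f)` as `Σ_{i ∈ S♭_f, ¬ ∀ β ∈ B(L⁺), cl♭ β ≠ i} p_i(0)` over the Borel-refined characteristic-polynomial classes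
`cl♭ γ = (charpoly (adelicVal γ), decide (∃ δ ∈ G(F), δ γ δ⁻¹ ∈ B(F)))` (★ `UnitaryGroupBorelRefinedClassMap`). This file
splits that sum, for ANY finite index set `S` and ANY summand `g` (measure-free bookkeeping, generic quadratic `E/F`
with `c² = 1`), along the trichotomy of ★ `UnitaryGroupCharpolyBorelClasses`:

* §1 **`not_forall_borelRefine_charpoly_ne_iff_exists`** — «`i` meets `B(F)`» READS `i.2 = true ∧
  i.1 = ((X − a)(X − b)(X − (c a)⁻¹)).map (E → 𝔸_E)` for some `a ∈ Eˣ`, `b ∈ E¹`; hence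
  **`filter_not_forall_borelRefine_charpoly_ne_eq`** (the socket's filter, rewritten).
* §2 `meetsBorel_iff_central_or_singular_or_hyperbolic`, **`filter_meetsBorel_eq_union₃`**, the pairwise disjointness lemmas, and
  **`sum_filter_meetsBorel_eq_sum_central_add_sum_singular_add_sum_hyperbolic`** —
  `Σ_{i ∈ S, i meets B} g i = Σ_{i ∈ S, CENTRAL} g i + Σ_{i ∈ S, SINGULAR} g i + Σ_{i ∈ S, HYPERBOLIC} g i` with
  `CENTRAL i := i.2 = true ∧ ∃ z ∈ E¹, i.1 = ((X − z)³).map`, `SINGULAR i := i.2 = true ∧ ∃ a ≠ b ∈ E¹,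
  i.1 = ((X − a)²(X − b)).map`, `HYPERBOLIC i := i.2 = true ∧ ∃ a b, c a · a ≠ 1, b ∈ E¹, i.1 = ((X − a)(X − b)(X − (c a)⁻¹)).map`
  — so each LAW 5 row ((L5-i) unipotent term [Rogawski Prop. 7.3.2], (L5-iii) singular [Prop. 7.2.2], (L5-ii) weighted
  hyperbolic [Prop. 6.3.1]) closes exactly one of the three sums.
* §3 `mem_filter_central_iff` ∕ `mem_filter_singular_iff` ∕ `mem_filter_hyperbolic_iff` — the three sockets' memberships.

## References

* J. D. Rogawski, *Automorphic Representations of Unitary Groups in Three Variables*, Ann. of Math. Stud. 123 (1990),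
  §7.6 (7.6.1), Props. 6.3.1, 7.2.2, 7.3.2 [Rogawski1990].
* J. Arthur, *A trace formula for reductive groups I*, Duke Math. J. 45 (1978), §8 [Arthur1978TraceFormulaI].
-/

set_option autoImplicit false

noncomputable section

open NumberField IsDedekindDomain Matrix Polynomial
open scoped Classical MatrixGroups

namespace Literature.NumberTheory.Automorphic

namespace UnitaryGroup

variable {F E : Type} [Field F] [NumberField F] [Field E] [NumberField E] [Algebra F E]
  {c : E ≃ₐ[F] E}

/-! ## §1 Reading the socket's filter: «`i` meets `B(F)`» iff `i = (Borel characteristic polynomial, true)` -/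

/-- **«The refined class `i` meets `B(F)`» iff `i.2 = true` and `i.1 = ((X − a)(X − b)(X − (c a)⁻¹)).map (E → 𝔸_E)` for
some `a ∈ Eˣ`, `b ∈ E¹`** (`c² = 1`, `N = 3`): the negation of the socket's `Finset.filter` predicate
`∀ β ∈ B(F), cl♭ β ≠ i`, through ★ `borelRefine_apply_of_mem_arithmeticBorel` and ★ (L5-0)
`exists_charpoly_eq_of_mem_arithmeticBorel_three` ∕ `exists_mem_arithmeticBorel_charpoly_eq_three`.
[cite: Rogawski1990, §7.6] [cite: Arthur1978TraceFormulaI, §8] -/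
theorem not_forall_borelRefine_charpoly_ne_iff_exists (hc : c * c = 1) (i : (AdeleRing (𝓞 E) E)[X] × Bool) :
    (¬ ∀ β : ↥(arithmeticBorel F E c 3),
        ((((adelicVal F E c 3 _ ((β : ↥(quasiSplit F E c 3).arithmeticSubgroup) : (quasiSplit F E c 3).Adelic) : GL (Fin 3) (AdeleRing (𝓞 E) E)) :
            Matrix (Fin 3) (Fin 3) (AdeleRing (𝓞 E) E)).charpoly,
          decide (∃ δ : ↥(quasiSplit F E c 3).arithmeticSubgroup, δ * (β : ↥(quasiSplit F E c 3).arithmeticSubgroup) * δ⁻¹ ∈ arithmeticBorel F E c 3)) : (AdeleRing (𝓞 E) E)[X] × Bool) ≠ i) ↔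
      i.2 = true ∧ ∃ a b : Eˣ, c (b : E) * (b : E) = 1 ∧ i.1 = ((X - C (a : E)) * (X - C (b : E)) * (X - C (c (a : E))⁻¹)).map (algebraMap E (AdeleRing (𝓞 E) E)) := by
  constructor
  · intro h
    obtain ⟨β, hβ⟩ := not_forall.1 h
    have hβi := not_not.1 hβ
    obtain ⟨a, b, hb, hab⟩ := exists_charpoly_eq_of_mem_arithmeticBorel_three (F := F) (c := c) β.2
    refine ⟨?_, a, b, hb, ?_⟩
    · rw [← hβi]
      exact decide_eq_true (exists_conj_mem_arithmeticBorel_of_mem β.2)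
    · rw [← hβi]
      exact hab
  · rintro ⟨h2, a, b, hb, h1⟩ h
    obtain ⟨β, hβB, -, hβd⟩ := exists_mem_arithmeticBorel_charpoly_eq_three (F := F) hc a b hb
    refine h ⟨β, hβB⟩ ?_
    obtain ⟨i1, i2⟩ := i
    simp only at h1 h2
    subst h1; subst h2
    simp only [Prod.mk.injEq, decide_eq_true_eq]
    exact ⟨hβd, exists_conj_mem_arithmeticBorel_of_mem hβB⟩

/-- **The socket's filter, rewritten**: `S.filter (¬ ∀ β ∈ B(F), cl♭ β ≠ ·) = S.filter (·.2 = true ∧ ·.1 is a Borel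
characteristic polynomial)`, for every `S`. [cite: Rogawski1990, §7.6] -/
theorem filter_not_forall_borelRefine_charpoly_ne_eq (hc : c * c = 1) (S : Finset ((AdeleRing (𝓞 E) E)[X] × Bool)) :
    S.filter (fun i : (AdeleRing (𝓞 E) E)[X] × Bool => ¬ ∀ β : ↥(arithmeticBorel F E c 3),
        ((((adelicVal F E c 3 _ ((β : ↥(quasiSplit F E c 3).arithmeticSubgroup) : (quasiSplit F E c 3).Adelic) : GL (Fin 3) (AdeleRing (𝓞 E) E)) :
            Matrix (Fin 3) (Fin 3) (AdeleRing (𝓞 E) E)).charpoly,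
          decide (∃ δ : ↥(quasiSplit F E c 3).arithmeticSubgroup, δ * (β : ↥(quasiSplit F E c 3).arithmeticSubgroup) * δ⁻¹ ∈ arithmeticBorel F E c 3)) : (AdeleRing (𝓞 E) E)[X] × Bool) ≠ i) =
      S.filter (fun i : (AdeleRing (𝓞 E) E)[X] × Bool => i.2 = true ∧ ∃ a b : Eˣ, c (b : E) * (b : E) = 1 ∧ i.1 = ((X - C (a : E)) * (X - C (b : E)) * (X - C (c (a : E))⁻¹)).map (algebraMap E (AdeleRing (𝓞 E) E))) :=
  Finset.filter_congr fun i _ => not_forall_borelRefine_charpoly_ne_iff_exists hc i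

/-! ## §2 The split by type -/

omit [NumberField F] in
/-- «Meets `B(F)`» is the disjunction of the three types (★ `meetsBorel_trichotomy`, and conversely each type is a
Borel characteristic polynomial: `(c z)⁻¹ = z`, `(c a)⁻¹ = a` on `E¹`). [cite: Rogawski1990, §7.6] -/
theorem meetsBorel_iff_central_or_singular_or_hyperbolic (i : (AdeleRing (𝓞 E) E)[X] × Bool) :
    (i.2 = true ∧ ∃ a b : Eˣ, c (b : E) * (b : E) = 1 ∧ i.1 = ((X - C (a : E)) * (X - C (b : E)) * (X - C (c (a : E))⁻¹)).map (algebraMap E (AdeleRing (𝓞 E) E))) ↔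
      (i.2 = true ∧ ∃ z : Eˣ, c (z : E) * (z : E) = 1 ∧ i.1 = ((X - C (z : E)) ^ 3).map (algebraMap E (AdeleRing (𝓞 E) E))) ∨
      (i.2 = true ∧ ∃ a b : Eˣ, c (a : E) * (a : E) = 1 ∧ c (b : E) * (b : E) = 1 ∧ (a : E) ≠ (b : E) ∧
        i.1 = ((X - C (a : E)) ^ 2 * (X - C (b : E))).map (algebraMap E (AdeleRing (𝓞 E) E))) ∨
      (i.2 = true ∧ ∃ a b : Eˣ, c (a : E) * (a : E) ≠ 1 ∧ c (b : E) * (b : E) = 1 ∧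
        i.1 = ((X - C (a : E)) * (X - C (b : E)) * (X - C (c (a : E))⁻¹)).map (algebraMap E (AdeleRing (𝓞 E) E))) := by
  constructor
  · rintro ⟨h2, hi⟩
    rcases meetsBorel_trichotomy (F := F) (c := c) hi with h | h | h
    · exact Or.inl ⟨h2, h⟩
    · exact Or.inr (Or.inl ⟨h2, h⟩)
    · exact Or.inr (Or.inr ⟨h2, h⟩)
  · rintro (⟨h2, z, hz, h1⟩ | ⟨h2, a, b, ha, hb, -, h1⟩ | ⟨h2, a, b, -, hb, h1⟩)
    · refine ⟨h2, z, z, hz, ?_⟩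
      rw [h1, (eq_inv_of_mul_eq_one_right hz).symm]
      congr 1
      ring
    · refine ⟨h2, a, b, hb, ?_⟩
      rw [h1, (eq_inv_of_mul_eq_one_right ha).symm]
      congr 1
      ring
    · exact ⟨h2, a, b, hb, h1⟩

/-- **The Borel-meeting classes are the disjoint union of the three type filters.** [cite: Rogawski1990, §7.6] -/
theorem filter_meetsBorel_eq_union₃ (hc : c * c = 1) (S : Finset ((AdeleRing (𝓞 E) E)[X] × Bool)) :
    S.filter (fun i : (AdeleRing (𝓞 E) E)[X] × Bool => ¬ ∀ β : ↥(arithmeticBorel F E c 3),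
        ((((adelicVal F E c 3 _ ((β : ↥(quasiSplit F E c 3).arithmeticSubgroup) : (quasiSplit F E c 3).Adelic) : GL (Fin 3) (AdeleRing (𝓞 E) E)) :
            Matrix (Fin 3) (Fin 3) (AdeleRing (𝓞 E) E)).charpoly,
          decide (∃ δ : ↥(quasiSplit F E c 3).arithmeticSubgroup, δ * (β : ↥(quasiSplit F E c 3).arithmeticSubgroup) * δ⁻¹ ∈ arithmeticBorel F E c 3)) : (AdeleRing (𝓞 E) E)[X] × Bool) ≠ i) =
      S.filter (fun i : (AdeleRing (𝓞 E) E)[X] × Bool => i.2 = true ∧ ∃ z : Eˣ, c (z : E) * (z : E) = 1 ∧ i.1 = ((X - C (z : E)) ^ 3).map (algebraMap E (AdeleRing (𝓞 E) E))) ∪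
      S.filter (fun i : (AdeleRing (𝓞 E) E)[X] × Bool => i.2 = true ∧ ∃ a b : Eˣ, c (a : E) * (a : E) = 1 ∧ c (b : E) * (b : E) = 1 ∧ (a : E) ≠ (b : E) ∧
        i.1 = ((X - C (a : E)) ^ 2 * (X - C (b : E))).map (algebraMap E (AdeleRing (𝓞 E) E))) ∪
      S.filter (fun i : (AdeleRing (𝓞 E) E)[X] × Bool => i.2 = true ∧ ∃ a b : Eˣ, c (a : E) * (a : E) ≠ 1 ∧ c (b : E) * (b : E) = 1 ∧
        i.1 = ((X - C (a : E)) * (X - C (b : E)) * (X - C (c (a : E))⁻¹)).map (algebraMap E (AdeleRing (𝓞 E) E))) := by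
  rw [filter_not_forall_borelRefine_charpoly_ne_eq hc S]
  ext i
  simp only [Finset.mem_filter, Finset.mem_union]
  rw [meetsBorel_iff_central_or_singular_or_hyperbolic (F := F) (c := c) i]
  constructor
  · rintro ⟨hS, h | h | h⟩
    · exact Or.inl (Or.inl ⟨hS, h⟩)
    · exact Or.inl (Or.inr ⟨hS, h⟩)
    · exact Or.inr ⟨hS, h⟩
  · rintro ((⟨hS, h⟩ | ⟨hS, h⟩) | ⟨hS, h⟩)
    · exact ⟨hS, Or.inl h⟩
    · exact ⟨hS, Or.inr (Or.inl h)⟩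
    · exact ⟨hS, Or.inr (Or.inr h)⟩

omit [NumberField F] in
/-- CENTRAL and SINGULAR are disjoint (★ `not_central_and_singular`). [cite: Rogawski1990, §7.6] -/
theorem disjoint_filter_central_filter_singular (S : Finset ((AdeleRing (𝓞 E) E)[X] × Bool)) :
    Disjoint (S.filter (fun i : (AdeleRing (𝓞 E) E)[X] × Bool => i.2 = true ∧ ∃ z : Eˣ, c (z : E) * (z : E) = 1 ∧ i.1 = ((X - C (z : E)) ^ 3).map (algebraMap E (AdeleRing (𝓞 E) E))))
      (S.filter (fun i : (AdeleRing (𝓞 E) E)[X] × Bool => i.2 = true ∧ ∃ a b : Eˣ, c (a : E) * (a : E) = 1 ∧ c (b : E) * (b : E) = 1 ∧ (a : E) ≠ (b : E) ∧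
        i.1 = ((X - C (a : E)) ^ 2 * (X - C (b : E))).map (algebraMap E (AdeleRing (𝓞 E) E)))) :=
  Finset.disjoint_filter.2 fun _ _ h₁ h₂ => not_central_and_singular (F := F) (c := c) h₁.2 h₂.2

omit [NumberField F] in
/-- CENTRAL and HYPERBOLIC are disjoint (★ `not_central_and_hyperbolic`). [cite: Rogawski1990, §7.6] -/
theorem disjoint_filter_central_filter_hyperbolic (hc : c * c = 1) (S : Finset ((AdeleRing (𝓞 E) E)[X] × Bool)) :
    Disjoint (S.filter (fun i : (AdeleRing (𝓞 E) E)[X] × Bool => i.2 = true ∧ ∃ z : Eˣ, c (z : E) * (z : E) = 1 ∧ i.1 = ((X - C (z : E)) ^ 3).map (algebraMap E (AdeleRing (𝓞 E) E))))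
      (S.filter (fun i : (AdeleRing (𝓞 E) E)[X] × Bool => i.2 = true ∧ ∃ a b : Eˣ, c (a : E) * (a : E) ≠ 1 ∧ c (b : E) * (b : E) = 1 ∧
        i.1 = ((X - C (a : E)) * (X - C (b : E)) * (X - C (c (a : E))⁻¹)).map (algebraMap E (AdeleRing (𝓞 E) E)))) :=
  Finset.disjoint_filter.2 fun _ _ h₁ h₃ => not_central_and_hyperbolic hc h₁.2 h₃.2

omit [NumberField F] in
/-- SINGULAR and HYPERBOLIC are disjoint (★ `not_singular_and_hyperbolic`). [cite: Rogawski1990, §7.6] -/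
theorem disjoint_filter_singular_filter_hyperbolic (hc : c * c = 1) (S : Finset ((AdeleRing (𝓞 E) E)[X] × Bool)) :
    Disjoint (S.filter (fun i : (AdeleRing (𝓞 E) E)[X] × Bool => i.2 = true ∧ ∃ a b : Eˣ, c (a : E) * (a : E) = 1 ∧ c (b : E) * (b : E) = 1 ∧ (a : E) ≠ (b : E) ∧
        i.1 = ((X - C (a : E)) ^ 2 * (X - C (b : E))).map (algebraMap E (AdeleRing (𝓞 E) E))))
      (S.filter (fun i : (AdeleRing (𝓞 E) E)[X] × Bool => i.2 = true ∧ ∃ a b : Eˣ, c (a : E) * (a : E) ≠ 1 ∧ c (b : E) * (b : E) = 1 ∧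
        i.1 = ((X - C (a : E)) * (X - C (b : E)) * (X - C (c (a : E))⁻¹)).map (algebraMap E (AdeleRing (𝓞 E) E)))) :=
  Finset.disjoint_filter.2 fun _ _ h₂ h₃ => not_singular_and_hyperbolic hc h₂.2 h₃.2

/-- **THE SOCKET SPLIT BY TYPE**: for every finite `S ⊆ 𝔸_E[X] × Bool` and every summand `g`,
`Σ_{i ∈ S, i meets B(F)} g i = Σ_{i ∈ S, CENTRAL} g i + Σ_{i ∈ S, SINGULAR} g i + Σ_{i ∈ S, HYPERBOLIC} g i` — applied to
the second sum of ★ `arthurTrace_eq_sum_orbital_add_sum_borelRefined_cm` (`g i := p_i(0)`, `S := S♭_f`), the Borel side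
of `J(f)` is the sum of the unipotent-type terms [Rogawski Prop. 7.3.2], the singular terms [Prop. 7.2.2] and the regular
hyperbolic terms [Prop. 6.3.1], each LAW 5 row closing one of them. [cite: Rogawski1990, §7.6]
[cite: Arthur1978TraceFormulaI, §8] -/
theorem sum_filter_meetsBorel_eq_sum_central_add_sum_singular_add_sum_hyperbolic (hc : c * c = 1)
    {M : Type*} [AddCommMonoid M] (S : Finset ((AdeleRing (𝓞 E) E)[X] × Bool)) (g : (AdeleRing (𝓞 E) E)[X] × Bool → M) :
    ∑ i ∈ S.filter (fun i : (AdeleRing (𝓞 E) E)[X] × Bool => ¬ ∀ β : ↥(arithmeticBorel F E c 3),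
        ((((adelicVal F E c 3 _ ((β : ↥(quasiSplit F E c 3).arithmeticSubgroup) : (quasiSplit F E c 3).Adelic) : GL (Fin 3) (AdeleRing (𝓞 E) E)) :
            Matrix (Fin 3) (Fin 3) (AdeleRing (𝓞 E) E)).charpoly,
          decide (∃ δ : ↥(quasiSplit F E c 3).arithmeticSubgroup, δ * (β : ↥(quasiSplit F E c 3).arithmeticSubgroup) * δ⁻¹ ∈ arithmeticBorel F E c 3)) : (AdeleRing (𝓞 E) E)[X] × Bool) ≠ i), g i =
      ∑ i ∈ S.filter (fun i : (AdeleRing (𝓞 E) E)[X] × Bool => i.2 = true ∧ ∃ z : Eˣ, c (z : E) * (z : E) = 1 ∧ i.1 = ((X - C (z : E)) ^ 3).map (algebraMap E (AdeleRing (𝓞 E) E))), g i +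
      ∑ i ∈ S.filter (fun i : (AdeleRing (𝓞 E) E)[X] × Bool => i.2 = true ∧ ∃ a b : Eˣ, c (a : E) * (a : E) = 1 ∧ c (b : E) * (b : E) = 1 ∧ (a : E) ≠ (b : E) ∧
        i.1 = ((X - C (a : E)) ^ 2 * (X - C (b : E))).map (algebraMap E (AdeleRing (𝓞 E) E))), g i +
      ∑ i ∈ S.filter (fun i : (AdeleRing (𝓞 E) E)[X] × Bool => i.2 = true ∧ ∃ a b : Eˣ, c (a : E) * (a : E) ≠ 1 ∧ c (b : E) * (b : E) = 1 ∧
        i.1 = ((X - C (a : E)) * (X - C (b : E)) * (X - C (c (a : E))⁻¹)).map (algebraMap E (AdeleRing (𝓞 E) E))), g i := by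
  rw [filter_meetsBorel_eq_union₃ hc S,
    Finset.sum_union ((Finset.disjoint_union_left).2
      ⟨disjoint_filter_central_filter_hyperbolic hc S, disjoint_filter_singular_filter_hyperbolic hc S⟩),
    Finset.sum_union (disjoint_filter_central_filter_singular (F := F) (c := c) S)]

/-! ## §3 Membership readings of the three sockets -/

omit [NumberField F] in
/-- Membership in the CENTRAL socket. [cite: Rogawski1990, §7.6] -/
theorem mem_filter_central_iff (S : Finset ((AdeleRing (𝓞 E) E)[X] × Bool)) (i : (AdeleRing (𝓞 E) E)[X] × Bool) :
    i ∈ S.filter (fun i : (AdeleRing (𝓞 E) E)[X] × Bool => i.2 = true ∧ ∃ z : Eˣ, c (z : E) * (z : E) = 1 ∧ i.1 = ((X - C (z : E)) ^ 3).map (algebraMap E (AdeleRing (𝓞 E) E))) ↔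
      i ∈ S ∧ i.2 = true ∧ ∃ z : Eˣ, c (z : E) * (z : E) = 1 ∧ i.1 = ((X - C (z : E)) ^ 3).map (algebraMap E (AdeleRing (𝓞 E) E)) :=
  Finset.mem_filter

omit [NumberField F] in
/-- Membership in the SINGULAR socket. [cite: Rogawski1990, §7.6] -/
theorem mem_filter_singular_iff (S : Finset ((AdeleRing (𝓞 E) E)[X] × Bool)) (i : (AdeleRing (𝓞 E) E)[X] × Bool) :
    i ∈ S.filter (fun i : (AdeleRing (𝓞 E) E)[X] × Bool => i.2 = true ∧ ∃ a b : Eˣ, c (a : E) * (a : E) = 1 ∧ c (b : E) * (b : E) = 1 ∧ (a : E) ≠ (b : E) ∧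
        i.1 = ((X - C (a : E)) ^ 2 * (X - C (b : E))).map (algebraMap E (AdeleRing (𝓞 E) E))) ↔
      i ∈ S ∧ i.2 = true ∧ ∃ a b : Eˣ, c (a : E) * (a : E) = 1 ∧ c (b : E) * (b : E) = 1 ∧ (a : E) ≠ (b : E) ∧
        i.1 = ((X - C (a : E)) ^ 2 * (X - C (b : E))).map (algebraMap E (AdeleRing (𝓞 E) E)) :=
  Finset.mem_filter

omit [NumberField F] in
/-- Membership in the HYPERBOLIC socket. [cite: Rogawski1990, §7.6] -/
theorem mem_filter_hyperbolic_iff (S : Finset ((AdeleRing (𝓞 E) E)[X] × Bool)) (i : (AdeleRing (𝓞 E) E)[X] × Bool) :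
    i ∈ S.filter (fun i : (AdeleRing (𝓞 E) E)[X] × Bool => i.2 = true ∧ ∃ a b : Eˣ, c (a : E) * (a : E) ≠ 1 ∧ c (b : E) * (b : E) = 1 ∧
        i.1 = ((X - C (a : E)) * (X - C (b : E)) * (X - C (c (a : E))⁻¹)).map (algebraMap E (AdeleRing (𝓞 E) E))) ↔
      i ∈ S ∧ i.2 = true ∧ ∃ a b : Eˣ, c (a : E) * (a : E) ≠ 1 ∧ c (b : E) * (b : E) = 1 ∧
        i.1 = ((X - C (a : E)) * (X - C (b : E)) * (X - C (c (a : E))⁻¹)).map (algebraMap E (AdeleRing (𝓞 E) E)) :=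
  Finset.mem_filter

end UnitaryGroup

end Literature.NumberTheory.Automorphic
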